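import Summits.RiemannHypothesis.RiemannHypothesis.Theorems.Splittings.ScrewLatticeTowerClassC
import HarnessLib

/-!
# Splittings — «ZOI-CLASS» (T35): the 0-or-∞ law in the tower vocabulary — FIN is the tower-killer, ZOI is class C

TREE PORT (rh-split typer-4 g0, lane «ZOI-CLASS», RULING #420) of theory-1 g13's kernel `T35ZeroInfinityClassC.lean`
(HOME/rh-splitx-theory-1/, sha16 e3d1ef80a3bd1b9d, 75 l; farm rc 0 / 0 sorry; referee ref-2 g7 SHORT READ): body VERBATIM;
port deltas = imports moved to the top, this `/-! -/` header (the kernel's own header text follows verbatim), and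
`set_option linter.dupNamespace false` (D-0017 namespace repeat). The kernel's header:

theory-1 g13 (cell rh-split) — SHAPE (i) «0-or-∞ LAW» IN THE TOWER VOCABULARY (director STANDARD 22:46:50Z:
PARTITION + SPRINKLE/TOWER TEST).  Scratch kernel, HOME copy (a typer ports it if the lead lanes it).
In the B16/B26 model class `ScrewLatticeTower.Config` the configuration analogue of
  FIN (`RuelleBand.CofiniteCriticalLine`: finitely many off-line quadruples) is NOT class C — every thin blind tower
      violates it (FIN is the TOWER-KILLER), while the analogue of
  ZOI (card zero-or-infinity-offline; `LindelofBridge.ZeroOrInfinityLoc` at σ₁ = 1/2: finitely many ⟹ none) IS class C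
      at every step h — it holds on every thin blind tower vacuously (ZOI is TOWER-BLIND) and fails exactly on the
      non-empty finite («sprinkle») configurations (ZOI is the SPRINKLE-KILLER);
and RH-emptiness = FIN ∧ ZOI.  So the pair partitions the adversaries of record exactly as the STANDARD asks; neither piece
has a technique (tree: `Cruxes/CofiniteCriticalLine/STRATEGY-CENSUS.md` §7 N5, Bagchi).  Nothing here bears on the truth of RH.
-/

-- D-0017: `Summit.RiemannHypothesis.RiemannHypothesis.…` duplicates the namespace BY DESIGN (single-problem summit).
set_option linter.dupNamespace false

noncomputable section

namespace Summit.RiemannHypothesis.RiemannHypothesis.Theorems.Splittings.ScrewLatticeTower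

/-- Configuration analogue of FIN: finitely many off-line quadruples. -/
def FinConfig (Z : Config) : Prop := Finite Z.ι

/-- Configuration analogue of ZOI («zero or infinity»): finitely many off-line quadruples only if none. -/
def ZoiConfig (Z : Config) : Prop := Finite Z.ι → IsEmpty Z.ι

/-- RH-emptiness of a configuration is exactly FIN ∧ ZOI. -/
theorem isEmpty_iff_finConfig_and_zoiConfig (Z : Config) : IsEmpty Z.ι ↔ FinConfig Z ∧ ZoiConfig Z := by
  refine ⟨fun h ↦ ⟨?_, fun _ ↦ h⟩, fun h ↦ h.2 h.1⟩
  haveI := h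
  exact (inferInstance : Finite Z.ι)

/-- A thin blind tower has infinitely many quadruples (its abscissae have no maximum). -/
theorem infinite_of_thinBlindClauses {h σs e : ℝ} {Z : Config} (hZ : ThinBlindClauses h σs e Z) :
    Infinite Z.ι := by
  obtain ⟨hne, -, -, -, -, -, hsup, -⟩ := hZ
  by_contra hinf
  haveI : Finite Z.ι := not_infinite_iff_finite.mp hinf
  haveI : Nonempty Z.ι := hne
  obtain ⟨i, hi⟩ := Finite.exists_max fun i ↦ (Z.κ₁ i).re
  obtain ⟨j, hj⟩ := hsup i
  exact absurd (hi j) (not_le.mpr hj)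

/-- **ZOI is class C at every step** (tower-blind: the clause list implies it, vacuously). -/
theorem classC_zoiConfig (h : ℝ) : ClassC h ZoiConfig :=
  ⟨1, 1, one_pos, one_pos, fun _ hZ hfin ↦
    ((not_finite_iff_infinite.mpr (infinite_of_thinBlindClauses hZ)) hfin).elim⟩

/-- **FIN is not class C at any step `h > 0`** (every thin blind tower violates it: the tower-killer). -/
theorem not_classC_finConfig {h : ℝ} (hh : 0 < h) : ¬ ClassC h FinConfig := by
  rintro ⟨σs, e, hσs, he, hP⟩
  obtain ⟨Z, hZ⟩ := exists_thinBlindClauses hh hσs he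
  exact (not_finite_iff_infinite.mpr (infinite_of_thinBlindClauses hZ)) (hP Z hZ)

/-- A one-quadruple («sprinkle») configuration. -/
def Config.single (m : ℝ) (κ : ℂ) : Config := ⟨Unit, fun _ ↦ m, fun _ ↦ m, fun _ ↦ κ, fun _ ↦ κ⟩

/-- **Partition of the adversaries.**  On a thin blind tower ZOI holds and FIN fails; on a non-empty finite configuration
FIN holds and ZOI fails. -/
theorem zoi_on_tower_fin_on_sprinkle {h σs e : ℝ} {Z : Config} (hZ : ThinBlindClauses h σs e Z)
    (W : Config) [Finite W.ι] [Nonempty W.ι] :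
    (ZoiConfig Z ∧ ¬ FinConfig Z) ∧ (FinConfig W ∧ ¬ ZoiConfig W) := by
  have hZinf := not_finite_iff_infinite.mpr (infinite_of_thinBlindClauses hZ)
  refine ⟨⟨fun hfin ↦ (hZinf hfin).elim, hZinf⟩, ⟨‹Finite W.ι›, fun hzoi ↦ ?_⟩⟩
  exact (hzoi ‹Finite W.ι›).false (Classical.arbitrary W.ι)

/-- The sprinkle instance: a single quadruple satisfies FIN and violates ZOI; so no criterion implied by ZOI alone, and no
criterion implied by FIN alone, forces emptiness. -/
theorem single_fin_not_zoi (m : ℝ) (κ : ℂ) :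
    FinConfig (Config.single m κ) ∧ ¬ ZoiConfig (Config.single m κ) := by
  refine ⟨(inferInstance : Finite Unit), fun hzoi ↦ ?_⟩
  exact (hzoi (inferInstance : Finite Unit)).false ()

end Summit.RiemannHypothesis.RiemannHypothesis.Theorems.Splittings.ScrewLatticeTower

end
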